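import Literature.Analysis.FluidPDE.NSCriticalClosureBesovPathSpace
import HarnessLib

/-!
# The critical Besov continuation criterion from GKP's Props. 2.1–2.3 in their faithful forms

Analysis/FluidPDE assembly file (proofs only: no definition, no named fact, no statement of the
tree is changed) for the named fact
`Literature.Analysis.FluidPDE.hasSmoothExtensionPast_of_eHomBesovNorm_bounded`
(`NSCriticalClosure.lean`; Gallagher–Koch–Planchon 2016, Thm. 1, contrapositive for classical
Leray–Hopf solutions from rapidly decaying data).

Since the verdict clean-up of 2026-08-15 the statements of GKP 2016, Props. 2.1, 2.2, 2.3 are read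
over Gallagher–Koch–Planchon's own solution class (`IsGKPSolutionOn`, `IsMaximalGKPSolution`,
`IsGKPCriticalElement`, `gkpCriticalThreshold` = `A_c`, all in `GKPCriticalElements.lean`), and the
faithful forms are displayed there as the **wanted named facts**
`gkp_exists_criticalElement_pathSpace`, `gkp_criticalElement_tendsto_zero_pathSpace`,
`gkp_rigidity_pathSpace` — verbatim the hypotheses `h` of
`gkp_exists_criticalElement_of_identification`, `gkp_criticalElement_tendsto_zero_of_identification`,
`gkp_rigidity_of_identification`. This file records that **these three statements, exactly as
displayed, imply the continuation criterion**, every other input being a theorem of the tree: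

* `gkpThm1_gkpClass_sup_of_gkpProps_gkpClass h1 h2 h3` — GKP's Theorem 1 over GKP's class in
  `sup` form for the GKP exponents `p = q = 3·2^k - 2` (GKP 2016, §2.1, p. 6: "Theorem 1 is an
  immediate corollary of the next three statements", run inside the class `𝓛^{1:∞}_p[T' < T]`):
  a maximal GKP solution with `0 < T` and `sup_{[0,T)} ‖U t‖ < ∞` forces `A_c ≤ sup < ∞`
  (`gkpCriticalThreshold_le_biSup`); Prop. 2.1 gives a critical element, Prop. 2.2 makes it tend to
  `0` in `𝓢'` at its lifespan, and Prop. 2.3 denies its maximality — contradiction;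
* `hasSmoothExtensionPast_of_eHomBesovNorm_bounded_of_gkpProps3_gkpClass h1 h2 h3 : _` — the
  criterion, by `hasSmoothExtensionPast_of_eHomBesovNorm_bounded_of_gkpThm1_pathSpace_sup`
  (`NSCriticalClosureBesovPathSpace.lean`; `IsMaximalGKPSolution` is literally its unfolded
  maximality over `IsBesovMildSolutionOn ∧ MemGKPPathSpace`, `memGKPPathSpace_iff = Iff.rfl`);
* `hasSmoothExtensionPast_of_eHomBesovNorm_bounded_of_and3_gkpClass` — the same as one implication.

Compared with `NSCriticalClosureBesovPathSpaceProps.lean` (the same chain for the unfolded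
"minimiser" shapes of the seats' earlier `…_of_pathSpace` reductions), the hypotheses here are the
official packaged forms, so that the discharge of the criterion is the one-liner
`…_of_gkpProps3_gkpClass X1_holds X2_holds X3_holds` once the three wanted facts are declared and
proved. No identification hypothesis `hId` and no GKP (1.9) is involved.

## References

* I. Gallagher, G. S. Koch, F. Planchon, *Blow-up of critical Besov norms at a potential
  Navier–Stokes singularity*, Comm. Math. Phys. 343 (2016) 39–82 = arXiv:1407.4156: Thm. 1, §2.1
  (the sets `A_c`, `𝒟_c`, Props. 2.1–2.3 and "Proof of Theorem 1", p. 6). [GKP2016]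
-/

noncomputable section

open MeasureTheory TemperedDistribution Set Function Filter
open _root_.Topology
open scoped SchwartzMap ENNReal NNReal

namespace Literature.Analysis.FluidPDE

/-- **GKP's Theorem 1 over GKP's class (`sup` form, GKP exponents) from the faithful
Props. 2.1–2.3** (Gallagher–Koch–Planchon 2016, §2.1 "Proof of Theorem 1", p. 6). Hypotheses:
`h1` = the wanted `gkp_exists_criticalElement_pathSpace` (Prop. 2.1: `A_c < ∞ ⟹ 𝒟_c ≠ ∅`),
`h2` = the wanted `gkp_criticalElement_tendsto_zero_pathSpace` (Prop. 2.2: critical elements tend to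
`0` in `𝓢'` at `T*`), `h3` = the wanted `gkp_rigidity_pathSpace` (Prop. 2.3: a GKP solution with
bounded critical norm tending to `0` in `𝓢'` at `T` is not maximal with lifespan `T`), verbatim
the hypotheses `h` of the three `…_of_identification` dissections of `GKPCriticalElements.lean`.
Conclusion: every maximal GKP solution of the class `(s_p, p, p)`, `p = 3·2^k - 2`, with lifespan
`0 < T` has `sup_{[0,T)} ‖U t‖_{Ḃ^{s_p}_{p,p}} = ∞`. [cite: GKP2016, Thm. 1 and §2.1] -/
theorem gkpThm1_gkpClass_sup_of_gkpProps_gkpClass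
    (h1 : ∀ ⦃ν : ℝ⦄, 0 < ν → ∀ ⦃p : ℝ≥0∞⦄ [Fact (1 ≤ p)], IsGKPExponent p →
      gkpCriticalThreshold ν p < ∞ →
        ∃ (T : ℝ) (u : ℝ → EuclideanSpace ℝ (Fin 3) → EuclideanSpace ℝ (Fin 3))
          (U : ℝ → 𝓢'(EuclideanSpace ℝ (Fin 3), EuclideanSpace ℂ (Fin 3))),
          IsGKPCriticalElement ν p T u U)
    (h2 : ∀ ⦃ν : ℝ⦄, 0 < ν → ∀ ⦃p : ℝ≥0∞⦄ [Fact (1 ≤ p)], IsGKPExponent p → ∀ ⦃T : ℝ⦄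
      ⦃u : ℝ → EuclideanSpace ℝ (Fin 3) → EuclideanSpace ℝ (Fin 3)⦄
      ⦃U : ℝ → 𝓢'(EuclideanSpace ℝ (Fin 3), EuclideanSpace ℂ (Fin 3))⦄,
      IsGKPCriticalElement ν p T u U → Tendsto U (𝓝[<] T) (𝓝 0))
    (h3 : ∀ ⦃ν : ℝ⦄, 0 < ν → ∀ ⦃p : ℝ≥0∞⦄ [Fact (1 ≤ p)], IsGKPExponent p → ∀ ⦃T : ℝ⦄, 0 < T →
      ∀ ⦃u : ℝ → EuclideanSpace ℝ (Fin 3) → EuclideanSpace ℝ (Fin 3)⦄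
        ⦃U : ℝ → 𝓢'(EuclideanSpace ℝ (Fin 3), EuclideanSpace ℂ (Fin 3))⦄,
        IsGKPSolutionOn p p T ν u U →
        ⨆ t ∈ Ico 0 T, FunctionSpaces.eHomBesovNorm (-1 + 3 / p.toReal) p p (U t) < ∞ →
        Tendsto U (𝓝[<] T) (𝓝 0) → ¬ IsMaximalGKPSolution p p T ν u U)
    ⦃ν : ℝ⦄ (hν : 0 < ν) ⦃p : ℝ≥0∞⦄ [Fact (1 ≤ p)] (hp : IsGKPExponent p) ⦃T : ℝ⦄ (hT : 0 < T)
    ⦃u : ℝ → EuclideanSpace ℝ (Fin 3) → EuclideanSpace ℝ (Fin 3)⦄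
    ⦃U : ℝ → 𝓢'(EuclideanSpace ℝ (Fin 3), EuclideanSpace ℂ (Fin 3))⦄
    (hmax : IsMaximalGKPSolution p p T ν u U) :
    ⨆ t ∈ Ico 0 T, FunctionSpaces.eHomBesovNorm (-1 + 3 / p.toReal) p p (U t) = ∞ := by
  by_contra hne
  -- `A_c ≤ sup_{[0,T)} ‖U t‖ < ∞`
  have hA : gkpCriticalThreshold ν p < ∞ :=
    (gkpCriticalThreshold_le_biSup hT hmax).trans_lt (lt_top_iff_ne_top.2 hne)
  -- Prop. 2.1: a critical element; Prop. 2.2: it tends to `0` at its lifespan;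
  -- Prop. 2.3: it is not maximal — contradiction
  obtain ⟨T₁, u₁, U₁, hc⟩ := h1 hν hp hA
  exact h3 hν hp hc.pos hc.isMaximal.isGKPSolutionOn hc.biSup_lt_top (h2 hν hp hc) hc.isMaximal

/-- **The critical Besov continuation criterion from the faithful GKP Props. 2.1–2.3** (the three
wanted named facts `gkp_exists_criticalElement_pathSpace`, `gkp_criticalElement_tendsto_zero_pathSpace`,
`gkp_rigidity_pathSpace`, verbatim, as `h1`, `h2`, `h3`): by Theorem 1 over GKP's class
(`gkpThm1_gkpClass_sup_of_gkpProps_gkpClass`) and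
`hasSmoothExtensionPast_of_eHomBesovNorm_bounded_of_gkpThm1_pathSpace_sup`, whose unfolded
maximality over `IsBesovMildSolutionOn ∧ MemGKPPathSpace` is `IsMaximalGKPSolution`. Every other
input is a theorem of the tree; no identification `hId`, no GKP (1.9).
[cite: GKP2016, Thm. 1 and §2.1] -/
theorem hasSmoothExtensionPast_of_eHomBesovNorm_bounded_of_gkpProps3_gkpClass
    (h1 : ∀ ⦃ν : ℝ⦄, 0 < ν → ∀ ⦃p : ℝ≥0∞⦄ [Fact (1 ≤ p)], IsGKPExponent p →
      gkpCriticalThreshold ν p < ∞ →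
        ∃ (T : ℝ) (u : ℝ → EuclideanSpace ℝ (Fin 3) → EuclideanSpace ℝ (Fin 3))
          (U : ℝ → 𝓢'(EuclideanSpace ℝ (Fin 3), EuclideanSpace ℂ (Fin 3))),
          IsGKPCriticalElement ν p T u U)
    (h2 : ∀ ⦃ν : ℝ⦄, 0 < ν → ∀ ⦃p : ℝ≥0∞⦄ [Fact (1 ≤ p)], IsGKPExponent p → ∀ ⦃T : ℝ⦄
      ⦃u : ℝ → EuclideanSpace ℝ (Fin 3) → EuclideanSpace ℝ (Fin 3)⦄
      ⦃U : ℝ → 𝓢'(EuclideanSpace ℝ (Fin 3), EuclideanSpace ℂ (Fin 3))⦄,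
      IsGKPCriticalElement ν p T u U → Tendsto U (𝓝[<] T) (𝓝 0))
    (h3 : ∀ ⦃ν : ℝ⦄, 0 < ν → ∀ ⦃p : ℝ≥0∞⦄ [Fact (1 ≤ p)], IsGKPExponent p → ∀ ⦃T : ℝ⦄, 0 < T →
      ∀ ⦃u : ℝ → EuclideanSpace ℝ (Fin 3) → EuclideanSpace ℝ (Fin 3)⦄
        ⦃U : ℝ → 𝓢'(EuclideanSpace ℝ (Fin 3), EuclideanSpace ℂ (Fin 3))⦄,
        IsGKPSolutionOn p p T ν u U →
        ⨆ t ∈ Ico 0 T, FunctionSpaces.eHomBesovNorm (-1 + 3 / p.toReal) p p (U t) < ∞ →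
        Tendsto U (𝓝[<] T) (𝓝 0) → ¬ IsMaximalGKPSolution p p T ν u U) :
    hasSmoothExtensionPast_of_eHomBesovNorm_bounded :=
  hasSmoothExtensionPast_of_eHomBesovNorm_bounded_of_gkpThm1_pathSpace_sup
    fun _ hν _ _ hp _ hT _ _ hB hPath hmax =>
      gkpThm1_gkpClass_sup_of_gkpProps_gkpClass h1 h2 h3 hν hp hT
        ⟨⟨hB, memGKPPathSpace_iff.1 hPath⟩, fun ⟨T', hT', v, V, hv, hvu⟩ =>
          hmax ⟨T', hT', v, V, ⟨hv.isBesovMildSolutionOn, memGKPPathSpace_iff.2 hv.pathNorm_lt_top⟩,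
            hvu⟩⟩

/-- **The same as one implication from the conjunction of the three faithful Props.**
[cite: GKP2016, Thm. 1 and §2.1] -/
theorem hasSmoothExtensionPast_of_eHomBesovNorm_bounded_of_and3_gkpClass
    (h : (∀ ⦃ν : ℝ⦄, 0 < ν → ∀ ⦃p : ℝ≥0∞⦄ [Fact (1 ≤ p)], IsGKPExponent p →
      gkpCriticalThreshold ν p < ∞ →
        ∃ (T : ℝ) (u : ℝ → EuclideanSpace ℝ (Fin 3) → EuclideanSpace ℝ (Fin 3))
          (U : ℝ → 𝓢'(EuclideanSpace ℝ (Fin 3), EuclideanSpace ℂ (Fin 3))),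
          IsGKPCriticalElement ν p T u U) ∧
      (∀ ⦃ν : ℝ⦄, 0 < ν → ∀ ⦃p : ℝ≥0∞⦄ [Fact (1 ≤ p)], IsGKPExponent p → ∀ ⦃T : ℝ⦄
        ⦃u : ℝ → EuclideanSpace ℝ (Fin 3) → EuclideanSpace ℝ (Fin 3)⦄
        ⦃U : ℝ → 𝓢'(EuclideanSpace ℝ (Fin 3), EuclideanSpace ℂ (Fin 3))⦄,
        IsGKPCriticalElement ν p T u U → Tendsto U (𝓝[<] T) (𝓝 0)) ∧
      (∀ ⦃ν : ℝ⦄, 0 < ν → ∀ ⦃p : ℝ≥0∞⦄ [Fact (1 ≤ p)], IsGKPExponent p → ∀ ⦃T : ℝ⦄, 0 < T →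
        ∀ ⦃u : ℝ → EuclideanSpace ℝ (Fin 3) → EuclideanSpace ℝ (Fin 3)⦄
          ⦃U : ℝ → 𝓢'(EuclideanSpace ℝ (Fin 3), EuclideanSpace ℂ (Fin 3))⦄,
          IsGKPSolutionOn p p T ν u U →
          ⨆ t ∈ Ico 0 T, FunctionSpaces.eHomBesovNorm (-1 + 3 / p.toReal) p p (U t) < ∞ →
          Tendsto U (𝓝[<] T) (𝓝 0) → ¬ IsMaximalGKPSolution p p T ν u U)) :
    hasSmoothExtensionPast_of_eHomBesovNorm_bounded :=
  hasSmoothExtensionPast_of_eHomBesovNorm_bounded_of_gkpProps3_gkpClass h.1 h.2.1 h.2.2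

end Literature.Analysis.FluidPDE

end
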